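import Summits.QuantumFields.BalabanUV.T4Continuum.Support.VariationalColourBochner

/-!
# T⁴ programme, spine node NE2 (U1a), lane P2 — SUPPLIER ITEM «V-COL-CLOSED», file A: THE SESQUILINEAR COLOUR DIRICHLET FORM AND THE
# FIRST VARIATION AT A CONSTRAINED MINIMISER, for 0-forms with values in a Hilbert space `E` transported by OPERATORS
# (the colour re-run of leaf-09-g3's `VariationalCovariantDirichletForm`; leaf REG⁺-colour, Euler–Lagrange half, part 1∕3)

NE2 formalisation swarm `b2b-balaban-t4-ne2-formalise-*`, leaf prover 02 (gen 5); register P2-sup, item «V-COL-CLOSED» (journal INTENT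
CLAIMS.log l.14931).  Carriers BY NAME: leaf-02-g4's `VariationalColourFederbush.{cDv, dirUv, Qcv}` (p214930) and leaf-09-g4's
`VariationalColourBochner.{nsqv, Dirv, DirAdjv, negLapv, ipv, ipv_DirAdjv}` (p215065).  New here:
 * §1 the sesquilinear colour Dirichlet form `dformv R g f := Σ_μ ipv (D_μ g) (D_μ f)` (conjugate-linear in `g`, linear in `f`), its
   Hermitian symmetry, (sesqui)linearity, diagonal `dformv f f = Σ_μ dirUv R f μ`, and the EXACT covariant summation by parts on the torus
   `ipv g (D†D f) = dformv g f` (`ipv_negLapv`, from `ipv_DirAdjv`) — no curvature term, no boundary, NO commutativity used;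
 * §2 FIRST VARIATION: the transported block average `Qcv` is ℂ-linear (`Qcv_add_smul`), `Σ_μ dirUv R (f + t•h) = Σ dirUv f
   + 2t·Re dformv h f + t²·Σ dirUv h` (`sum_dirUv_add_smul`), hence if `f` minimises `Σ_μ dirUv R` on the affine fibre `{g : Qcv T g = μ}`
   then `dformv h f = 0` for every `h ∈ ker Qcv T` (`dformv_eq_zero_of_isMin`), i.e. `ipv h (D†D f) = 0` on `ker Qcv T`
   (`ipv_negLapv_eq_zero_of_isMin`) — the Euler–Lagrange equation of the colour constrained minimiser.
File B (`Support/VariationalColourRegularity`) draws the block structure of `D†D f` for UNITARY site operators (the multiplier) and the END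
`nsqv (D†D f) ≤ (Λ∕n^d)·Σ_μ dirUv R f` by UB⁺-duality; file C the physical units and the `hREG` binder of `colour_pair_bracket` (p215316).

HONEST FRAMING (T4-DAG p. 1).  Model level: bond operators `R` (DATA, no size assumption here) and site operators `T` (DATA) on the
level-`n` torus over the unit torus; lattice units; 0-form sector; ONE level.  Elementary finite-dimensional variational calculus,
[folklore]; nothing printed is a hypothesis; no `def … : Prop`; no `sorry`; axioms standard.  NE2 NOT proved; spine PROVED 0∕9; rung (B)+1
finite T⁴ — NOT infinite volume, NOT a mass gap, NOT Clay.  HONEST DEPENDENCY (cell, verbatim): continuum YM on T⁴ ⇐ BetaPertH ∧ nine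
spine estimates (0/9 proved); BetaPertH ⇐ (D1) ∧ (D4) ∧ CAP+tail; G-an2-4 gates asym, D1 and NE2/3/4.
-/

noncomputable section

namespace Summit.QuantumFields.BalabanUV.T4Continuum.VariationalColourDirichletForm

open Finset
open scoped InnerProductSpace ComplexConjugate
open Literature.MathematicalPhysics.QuantumFieldTheory.Balaban1983to89.B5Prop11Plancherel (Tor fine unitVec)
open Literature.MathematicalPhysics.QuantumFieldTheory.Balaban1983to89.B5Block118 (bpt)
open Summit.QuantumFields.BalabanUV.T4Continuum.VariationalColourFederbush (cDv dirUv Qcv dirUv_nonneg)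
open Summit.QuantumFields.BalabanUV.T4Continuum.VariationalColourBochner
  (nsqv Dirv DirAdjv negLapv ipv ipv_self conj_ipv ipv_sum_right ipv_DirAdjv sum_nsqv_Dirv_eq)

variable {d : ℕ} {E : Type*} [NormedAddCommGroup E] [InnerProductSpace ℂ E] [CompleteSpace E]

/-! ## §1 The sesquilinear colour Dirichlet form; exact summation by parts -/

section General

variable (N : Fin d → ℕ) [∀ μ, NeZero (N μ)]

/-- the sesquilinear colour Dirichlet form `Σ_μ Σ_x ⟪(D_μ g)(x), (D_μ f)(x)⟫` (conjugate-linear in `g`, linear in `f`). [folklore] -/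
def dformv (R : Tor N → Fin d → (E →L[ℂ] E)) (g f : Tor N → E) : ℂ := ∑ μ, ipv N (Dirv N R μ g) (Dirv N R μ f)

omit [∀ μ, NeZero (N μ)] [CompleteSpace E] in
/-- `D_μ` is additive in the field. [folklore] -/
theorem Dirv_add (R : Tor N → Fin d → (E →L[ℂ] E)) (μ : Fin d) (f g : Tor N → E) :
    Dirv N R μ (f + g) = Dirv N R μ f + Dirv N R μ g := by
  funext x
  simp only [Dirv, cDv, Pi.add_apply, map_add]
  abel

omit [∀ μ, NeZero (N μ)] [CompleteSpace E] in
/-- `D_μ` is homogeneous in the field. [folklore] -/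
theorem Dirv_smul (R : Tor N → Fin d → (E →L[ℂ] E)) (μ : Fin d) (c : ℂ) (f : Tor N → E) :
    Dirv N R μ (c • f) = c • Dirv N R μ f := by
  funext x
  simp only [Dirv, cDv, Pi.smul_apply, map_smul, smul_sub]

omit [∀ μ, NeZero (N μ)] [CompleteSpace E] in
/-- `D_μ 0 = 0`. [folklore] -/
theorem Dirv_zero (R : Tor N → Fin d → (E →L[ℂ] E)) (μ : Fin d) : Dirv N R μ (0 : Tor N → E) = 0 := by
  funext x
  simp [Dirv, cDv]

omit [CompleteSpace E] in
/-- additivity of the pairing in the first slot. [folklore] -/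
theorem ipv_add_left (g₁ g₂ f : Tor N → E) : ipv N (g₁ + g₂) f = ipv N g₁ f + ipv N g₂ f := by
  unfold ipv
  rw [← sum_add_distrib]
  exact sum_congr rfl fun x _ => by rw [Pi.add_apply, inner_add_left]

omit [CompleteSpace E] in
/-- additivity of the pairing in the second slot. [folklore] -/
theorem ipv_add_right (g f₁ f₂ : Tor N → E) : ipv N g (f₁ + f₂) = ipv N g f₁ + ipv N g f₂ := by
  unfold ipv
  rw [← sum_add_distrib]
  exact sum_congr rfl fun x _ => by rw [Pi.add_apply, inner_add_right]

omit [CompleteSpace E] in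
/-- the pairing of a difference of fields (first slot). [folklore] -/
theorem ipv_sub_left (g₁ g₂ f : Tor N → E) : ipv N (g₁ - g₂) f = ipv N g₁ f - ipv N g₂ f := by
  unfold ipv
  rw [← sum_sub_distrib]
  exact sum_congr rfl fun x _ => by rw [Pi.sub_apply, inner_sub_left]

omit [CompleteSpace E] in
/-- conjugate-homogeneity of the pairing in the first slot. [folklore] -/
theorem ipv_smul_left (c : ℂ) (g f : Tor N → E) : ipv N (c • g) f = conj c * ipv N g f := by
  unfold ipv
  rw [mul_sum]
  exact sum_congr rfl fun x _ => by rw [Pi.smul_apply, inner_smul_left]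

omit [CompleteSpace E] in
/-- homogeneity of the pairing in the second slot. [folklore] -/
theorem ipv_smul_right (c : ℂ) (g f : Tor N → E) : ipv N g (c • f) = c * ipv N g f := by
  unfold ipv
  rw [mul_sum]
  exact sum_congr rfl fun x _ => by rw [Pi.smul_apply, inner_smul_right]

omit [CompleteSpace E] in
/-- the pairing against the zero field (first slot). [folklore] -/
theorem ipv_zero_left (f : Tor N → E) : ipv N (0 : Tor N → E) f = 0 := by
  unfold ipv
  exact sum_eq_zero fun x _ => by rw [Pi.zero_apply, inner_zero_left]

omit [CompleteSpace E] in
/-- Hermitian symmetry of the form. [folklore] -/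
theorem conj_dformv (R : Tor N → Fin d → (E →L[ℂ] E)) (g f : Tor N → E) : conj (dformv N R g f) = dformv N R f g := by
  unfold dformv
  rw [map_sum]
  exact sum_congr rfl fun μ _ => conj_ipv N _ _

omit [CompleteSpace E] in
/-- the diagonal of the form is the colour Dirichlet sum: `dformv f f = Σ_μ dirUv R f μ` (leaf-02-g4's `dirUv`, BY NAME). [folklore] -/
theorem dformv_self (R : Tor N → Fin d → (E →L[ℂ] E)) (f : Tor N → E) :
    dformv N R f f = ((∑ μ, dirUv N R f μ : ℝ) : ℂ) := by
  unfold dformv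
  rw [← sum_nsqv_Dirv_eq]
  push_cast
  exact sum_congr rfl fun μ _ => ipv_self N _

omit [CompleteSpace E] in
/-- additivity of the form in the first slot. [folklore] -/
theorem dformv_add_left (R : Tor N → Fin d → (E →L[ℂ] E)) (g₁ g₂ f : Tor N → E) :
    dformv N R (g₁ + g₂) f = dformv N R g₁ f + dformv N R g₂ f := by
  unfold dformv
  rw [← sum_add_distrib]
  exact sum_congr rfl fun μ _ => by rw [Dirv_add, ipv_add_left]

omit [CompleteSpace E] in
/-- additivity of the form in the second slot. [folklore] -/
theorem dformv_add_right (R : Tor N → Fin d → (E →L[ℂ] E)) (g f₁ f₂ : Tor N → E) :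
    dformv N R g (f₁ + f₂) = dformv N R g f₁ + dformv N R g f₂ := by
  unfold dformv
  rw [← sum_add_distrib]
  exact sum_congr rfl fun μ _ => by rw [Dirv_add, ipv_add_right]

omit [CompleteSpace E] in
/-- conjugate-homogeneity of the form in the first slot. [folklore] -/
theorem dformv_smul_left (R : Tor N → Fin d → (E →L[ℂ] E)) (c : ℂ) (g f : Tor N → E) :
    dformv N R (c • g) f = conj c * dformv N R g f := by
  unfold dformv
  rw [mul_sum]
  exact sum_congr rfl fun μ _ => by rw [Dirv_smul, ipv_smul_left]

omit [CompleteSpace E] in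
/-- homogeneity of the form in the second slot. [folklore] -/
theorem dformv_smul_right (R : Tor N → Fin d → (E →L[ℂ] E)) (c : ℂ) (g f : Tor N → E) :
    dformv N R g (c • f) = c * dformv N R g f := by
  unfold dformv
  rw [mul_sum]
  exact sum_congr rfl fun μ _ => by rw [Dirv_smul, ipv_smul_right]

omit [CompleteSpace E] in
/-- the form against the zero field (first slot). [folklore] -/
theorem dformv_zero_left (R : Tor N → Fin d → (E →L[ℂ] E)) (f : Tor N → E) : dformv N R (0 : Tor N → E) f = 0 := by
  unfold dformv
  exact sum_eq_zero fun μ _ => by rw [Dirv_zero, ipv_zero_left]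

/-- **EXACT COVARIANT SUMMATION BY PARTS** on the torus, operator transporters: `Σ_x ⟪g x, (D†D f)(x)⟫ = Σ_μ Σ_x ⟪(D_μ g)(x), (D_μ f)(x)⟫`
(leaf-09-g4's adjointness `ipv_DirAdjv` summed over directions) — no curvature term, no boundary, no commutativity. [folklore] -/
theorem ipv_negLapv (R : Tor N → Fin d → (E →L[ℂ] E)) (g f : Tor N → E) : ipv N g (negLapv N R f) = dformv N R g f := by
  have h : negLapv N R f = fun x => ∑ μ ∈ (univ : Finset (Fin d)), DirAdjv N R μ (Dirv N R μ f) x := rfl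
  rw [h, ipv_sum_right]
  exact sum_congr rfl fun μ _ => ipv_DirAdjv N R μ g _

/-- the same read from the other side: `Σ_x ⟪(D†D f)(x), g x⟫ = conj (dformv g f) = dformv f g`. [folklore] -/
theorem ipv_negLapv_left (R : Tor N → Fin d → (E →L[ℂ] E)) (f g : Tor N → E) : ipv N (negLapv N R f) g = dformv N R f g := by
  rw [← conj_ipv, ipv_negLapv, conj_dformv]

omit [CompleteSpace E] in
/-- expansion of the colour Dirichlet sum along a real line: `Σ_μ dirUv R (f + t•h) = Σ dirUv f + 2t·Re dformv h f + t²·Σ dirUv h`.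
[folklore] -/
theorem sum_dirUv_add_smul (R : Tor N → Fin d → (E →L[ℂ] E)) (f h : Tor N → E) (t : ℝ) :
    ∑ μ, dirUv N R (f + (t : ℂ) • h) μ
      = ∑ μ, dirUv N R f μ + 2 * t * (dformv N R h f).re + t ^ 2 * ∑ μ, dirUv N R h μ := by
  set w : ℂ := dformv N R h f with hw
  have hfh : dformv N R f h = conj w := by rw [hw, conj_dformv]
  have e : ((∑ μ, dirUv N R (f + (t : ℂ) • h) μ : ℝ) : ℂ)
      = ((∑ μ, dirUv N R f μ : ℝ) : ℂ) + (t : ℂ) * conj w + (t : ℂ) * w + (t : ℂ) * ((t : ℂ) * ((∑ μ, dirUv N R h μ : ℝ) : ℂ)) := by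
    rw [← dformv_self, dformv_add_left, dformv_add_right, dformv_smul_right, dformv_smul_left, Complex.conj_ofReal,
      dformv_add_right, dformv_smul_right, dformv_self, dformv_self, hfh, ← hw]
    ring
  have hre : (t : ℂ) * conj w + (t : ℂ) * w = ((2 * t * w.re : ℝ) : ℂ) := by
    rw [← mul_add, add_comm, Complex.add_conj]; push_cast; ring
  rw [add_assoc ((∑ μ, dirUv N R f μ : ℝ) : ℂ), hre] at e
  have e' : ((∑ μ, dirUv N R (f + (t : ℂ) • h) μ : ℝ) : ℂ)
      = ((∑ μ, dirUv N R f μ + 2 * t * w.re + t ^ 2 * ∑ μ, dirUv N R h μ : ℝ) : ℂ) := by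
    rw [e]; push_cast; ring
  exact Complex.ofReal_injective e'

end General

/-! ## §2 First variation at a constrained minimiser of the colour Dirichlet sum on a fibre of the transported block average -/

section Variation

variable (n : ℕ) [NeZero n] (M : Fin d → ℕ) [hM : ∀ μ, NeZero (M μ)]

omit [NeZero n] hM [InnerProductSpace ℂ E] [CompleteSpace E] in
/-- the transported block average is ℂ-LINEAR in the field (the site operators are linear): `Qcv T (f + c•h) = Qcv T f + c•Qcv T h`.
[folklore] -/
theorem Qcv_add_smul [NormedSpace ℂ E] (T : Tor (fine n M) → (E →L[ℂ] E)) (f h : Tor (fine n M) → E) (c : ℂ) :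
    Qcv n M T (f + c • h) = Qcv n M T f + c • Qcv n M T h := by
  funext z
  simp only [Qcv, Pi.add_apply, Pi.smul_apply, map_add, map_smul, sum_add_distrib, smul_add, Finset.smul_sum]
  congr 1
  exact sum_congr rfl fun j _ => smul_comm _ _ _

omit [NeZero n] hM [InnerProductSpace ℂ E] [CompleteSpace E] in
/-- `Qcv T 0 = 0`. [folklore] -/
theorem Qcv_zero [NormedSpace ℂ E] (T : Tor (fine n M) → (E →L[ℂ] E)) : Qcv n M T (0 : Tor (fine n M) → E) = 0 := by
  funext z
  simp [Qcv]

omit [CompleteSpace E] in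
/-- **FIRST VARIATION**: if `f` minimises the colour Dirichlet sum `Σ_μ dirUv R` on the affine fibre `{g : Qcv T g = μ}` then the sesquilinear
form vanishes against the kernel of `Qcv T`: `dformv R h f = 0` whenever `Qcv T h = 0`. [folklore] -/
theorem dformv_eq_zero_of_isMin (T : Tor (fine n M) → (E →L[ℂ] E)) (R : Tor (fine n M) → Fin d → (E →L[ℂ] E)) {μ : Tor M → E}
    {f : Tor (fine n M) → E} (hf : Qcv n M T f = μ)
    (hmin : ∀ g, Qcv n M T g = μ → ∑ ν, dirUv (fine n M) R f ν ≤ ∑ ν, dirUv (fine n M) R g ν)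
    {h : Tor (fine n M) → E} (hh : Qcv n M T h = 0) : dformv (fine n M) R h f = 0 := by
  -- real part, for any kernel element
  have hre : ∀ h' : Tor (fine n M) → E, Qcv n M T h' = 0 → (dformv (fine n M) R h' f).re = 0 := by
    intro h' hh'
    -- `0 ≤ 2tb + t²c` for all real `t` (with `c = Σ dirUv h' ≥ 0`) forces `b = 0`: evaluate at `t = −b/(c+1)`
    set b : ℝ := (dformv (fine n M) R h' f).re
    set c : ℝ := ∑ ν, dirUv (fine n M) R h' ν
    have hc : 0 ≤ c := sum_nonneg fun ν _ => dirUv_nonneg _ _ _ _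
    have hq : ∀ t : ℝ, 0 ≤ 2 * t * b + t ^ 2 * c := fun t => by
      have hfib : Qcv n M T (f + (t : ℂ) • h') = μ := by rw [Qcv_add_smul, hh', smul_zero, add_zero, hf]
      have := hmin _ hfib
      rw [sum_dirUv_add_smul] at this
      linarith
    have hc1 : 0 < c + 1 := by linarith
    have h1 := hq (-b / (c + 1))
    have e : 2 * (-b / (c + 1)) * b + (-b / (c + 1)) ^ 2 * c = -(b ^ 2 * (c + 2)) / (c + 1) ^ 2 := by
      field_simp; ring
    rw [e] at h1
    have h2 : b ^ 2 * (c + 2) ≤ 0 := by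
      have := mul_nonneg h1 (le_of_lt (pow_pos hc1 2))
      rw [div_mul_cancel₀ _ (ne_of_gt (pow_pos hc1 2))] at this
      linarith
    nlinarith [sq_nonneg b]
  have h1 := hre h hh
  have h2 := hre (Complex.I • h) (by
    have := Qcv_add_smul n M T 0 h Complex.I
    rw [zero_add, hh, smul_zero, add_zero, Qcv_zero] at this
    exact this)
  rw [dformv_smul_left, Complex.conj_I] at h2
  have him : (dformv (fine n M) R h f).im = 0 := by
    have : (-Complex.I * dformv (fine n M) R h f).re = (dformv (fine n M) R h f).im := by
      simp [Complex.mul_re]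
    rw [← this]; exact h2
  exact Complex.ext h1 him

/-- **EULER–LAGRANGE, pairing form**: at a constrained minimiser, `Σ_x ⟪h x, (D†D f)(x)⟫ = 0` for every `h ∈ ker Qcv T`. [folklore] -/
theorem ipv_negLapv_eq_zero_of_isMin (T : Tor (fine n M) → (E →L[ℂ] E)) (R : Tor (fine n M) → Fin d → (E →L[ℂ] E)) {μ : Tor M → E}
    {f : Tor (fine n M) → E} (hf : Qcv n M T f = μ)
    (hmin : ∀ g, Qcv n M T g = μ → ∑ ν, dirUv (fine n M) R f ν ≤ ∑ ν, dirUv (fine n M) R g ν)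
    {h : Tor (fine n M) → E} (hh : Qcv n M T h = 0) : ipv (fine n M) h (negLapv (fine n M) R f) = 0 := by
  rw [ipv_negLapv]
  exact dformv_eq_zero_of_isMin n M T R hf hmin hh

end Variation

end Summit.QuantumFields.BalabanUV.T4Continuum.VariationalColourDirichletForm

end
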